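import Mathlib.MeasureTheory.Integral.Prod
import Mathlib.MeasureTheory.Constructions.Pi
import HarnessLib

/-!
# Setwise total-variation bounds between finite measures

A small calculus for the predicate `TVClose μ ν ε : ∀ E measurable, |μ(E) − ν(E)| ≤ ε`
(i.e. the total-variation distance `sup_E |μ(E) − ν(E)|` is at most `ε`), in the form used by
hybrid (Lindeberg-type replacement) arguments:

* monotonicity, symmetry, triangle inequality, the trivial bound `1` for probability measures;
* stability under push-forward by a common measurable map (data processing);
* stability under product with a common finite measure, and under finite products (tensorisation:
  `‖⊗μᵢ − ⊗νᵢ‖ ≤ ∑ ‖μᵢ − νᵢ‖`);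
* the **mixture bound**: if two jointly measurable families `F a`, `G a` of maps satisfy
  `‖κ ∘ (F a)⁻¹ − κ ∘ (G a)⁻¹‖ ≤ ε(a)` for every `a`, then the laws of `(a, F a b)` and
  `(a, G a b)` under `ρ ⊗ κ` are `∫ ε dρ`-close;
* the **one-sided density criterion**: `ν(E) ≤ μ(E) + δ` for all `E` (for two probability
  measures) gives `‖μ − ν‖ ≤ δ`, in particular a pointwise lower bound `q ≥ (1 − ε) p` between
  probability densities gives `‖q·λ − p·λ‖ ≤ ∫ ε p dλ`.

All statements are standard measure theory; they are written for `Measure.real` so that they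
apply verbatim to statements phrased as `|μ.real E − ν.real E| ≤ ε`.

## References

* D. A. Levin, Y. Peres, E. L. Wilmer, *Markov chains and mixing times*, AMS 2009, §4.1–4.2
  (total variation distance, coupling and data processing).
-/

open MeasureTheory
open scoped ENNReal

namespace Literature.MeasureTheory.TotalVariation

open _root_.MeasureTheory

variable {α β γ : Type*} [MeasurableSpace α] [MeasurableSpace β] [MeasurableSpace γ]

/-- `TVClose μ ν ε`: the measures `μ` and `ν` differ by at most `ε` on every measurable set,
`|μ(E) − ν(E)| ≤ ε` (real-valued measures of sets, `Measure.real`). For finite measures this says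
that the total variation distance `sup_E |μ(E) − ν(E)|` is at most `ε`. [folklore] -/
def TVClose (μ ν : Measure α) (ε : ℝ) : Prop :=
  ∀ E : Set α, MeasurableSet E → |μ.real E - ν.real E| ≤ ε

namespace TVClose

variable {μ ν ρ : Measure α} {ε ε' : ℝ}

/-- The closeness parameter is nonnegative (test the empty set). [folklore] -/
theorem nonneg (h : TVClose μ ν ε) : 0 ≤ ε :=
  le_trans (abs_nonneg _) (h ∅ MeasurableSet.empty)

/-- Monotonicity in the parameter. [folklore] -/
theorem mono (h : TVClose μ ν ε) (hε : ε ≤ ε') : TVClose μ ν ε' :=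
  fun E hE => (h E hE).trans hε

/-- Symmetry. [folklore] -/
theorem symm (h : TVClose μ ν ε) : TVClose ν μ ε :=
  fun E hE => by rw [abs_sub_comm]; exact h E hE

/-- Reflexivity with parameter `0`. [folklore] -/
theorem refl (μ : Measure α) : TVClose μ μ 0 :=
  fun E _ => by simp

/-- Triangle inequality. [folklore] -/
theorem triangle (h₁ : TVClose μ ν ε) (h₂ : TVClose ν ρ ε') : TVClose μ ρ (ε + ε') :=
  fun E hE => by
    calc |μ.real E - ρ.real E| = |(μ.real E - ν.real E) + (ν.real E - ρ.real E)| := by ring_nf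
      _ ≤ |μ.real E - ν.real E| + |ν.real E - ρ.real E| := abs_add_le _ _
      _ ≤ ε + ε' := add_le_add (h₁ E hE) (h₂ E hE)

/-- Equal measures are `ε`-close for every `ε ≥ 0`. [folklore] -/
theorem of_eq (h : μ = ν) (hε : 0 ≤ ε) : TVClose μ ν ε :=
  fun E _ => by rw [h, sub_self, abs_zero]; exact hε

/-- Two probability measures are always `1`-close. [folklore] -/
theorem of_prob (μ ν : Measure α) [IsProbabilityMeasure μ] [IsProbabilityMeasure ν] :
    TVClose μ ν 1 := fun E _ => by
  rw [abs_le]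
  constructor
  · have h1 : 0 ≤ μ.real E := measureReal_nonneg
    have h2 : ν.real E ≤ 1 := measureReal_le_one
    linarith
  · have h1 : μ.real E ≤ 1 := measureReal_le_one
    have h2 : 0 ≤ ν.real E := measureReal_nonneg
    linarith

/-- **Data processing**: push-forward by a common measurable map does not increase the setwise
distance. [folklore] -/
theorem map (h : TVClose μ ν ε) {f : α → β} (hf : Measurable f) :
    TVClose (μ.map f) (ν.map f) ε := fun E hE => by
  rw [map_measureReal_apply hf hE, map_measureReal_apply hf hE]
  exact h _ (hf hE)

end TVClose

/-! ### One-sided criteria -/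

/-- **One-sided criterion.** If `ν(E) ≤ μ(E) + δ` for every measurable `E` and both are
probability measures, then `|μ(E) − ν(E)| ≤ δ` for every measurable `E` (apply the hypothesis to
`E` and to `Eᶜ`). [folklore] -/
theorem tvClose_of_forall_le_add {μ ν : Measure α} [IsProbabilityMeasure μ]
    [IsProbabilityMeasure ν] {δ : ℝ≥0∞} (hδ : δ ≠ ∞)
    (h : ∀ E, MeasurableSet E → ν E ≤ μ E + δ) : TVClose μ ν δ.toReal := by
  intro E hE
  have hE' := h E hE
  have hEc := h Eᶜ hE.compl
  have r1 : ν.real E ≤ μ.real E + δ.toReal := by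
    have := ENNReal.toReal_mono (by simp [hδ, measure_ne_top]) hE'
    rwa [ENNReal.toReal_add (measure_ne_top _ _) hδ] at this
  have r2 : ν.real Eᶜ ≤ μ.real Eᶜ + δ.toReal := by
    have := ENNReal.toReal_mono (by simp [hδ, measure_ne_top]) hEc
    rwa [ENNReal.toReal_add (measure_ne_top _ _) hδ] at this
  rw [measureReal_compl hE, measureReal_compl hE, probReal_univ, probReal_univ] at r2
  rw [abs_le]
  constructor <;> linarith

/-- **Density criterion.** Let `p, q` be probability densities with respect to `λ` with
`p ≤ q + ε·p` pointwise (a subtraction-free form of `q ≥ (1 − ε) p`). Then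
`|(q·λ)(E) − (p·λ)(E)| ≤ ∫ ε p dλ` for every measurable `E`. [folklore] -/
theorem tvClose_withDensity_of_le {lam : Measure α} {p q ε : α → ℝ≥0∞}
    (hq : Measurable q) [IsProbabilityMeasure (lam.withDensity p)]
    [IsProbabilityMeasure (lam.withDensity q)]
    (h : ∀ x, p x ≤ q x + ε x * p x) (hfin : ∫⁻ x, ε x * p x ∂lam ≠ ∞) :
    TVClose (lam.withDensity q) (lam.withDensity p) (∫⁻ x, ε x * p x ∂lam).toReal := by
  refine tvClose_of_forall_le_add hfin fun E hE => ?_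
  rw [withDensity_apply _ hE, withDensity_apply _ hE]
  calc ∫⁻ x in E, p x ∂lam ≤ ∫⁻ x in E, q x + ε x * p x ∂lam := lintegral_mono fun x => h x
    _ = ∫⁻ x in E, q x ∂lam + ∫⁻ x in E, ε x * p x ∂lam := lintegral_add_left hq _
    _ ≤ ∫⁻ x in E, q x ∂lam + ∫⁻ x, ε x * p x ∂lam := by
        gcongr; exact Measure.restrict_le_self

/-! ### Products and mixtures -/

section Prod

variable {μ ν : Measure α} {ε : ℝ}

/-- Sections of a measurable set of a product, measured by a finite measure, as a real-valued
integrand: `(μ ⊗ κ)(E) = ∫ μ… ` bookkeeping. [folklore] -/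
theorem measureReal_prod_eq_integral (μ : Measure α) (κ : Measure β) [SFinite κ] [IsFiniteMeasure μ]
    [SFinite μ] {E : Set (α × β)} (hE : MeasurableSet E) :
    (μ.prod κ).real E = ∫ y, μ.real ((fun x => (x, y)) ⁻¹' E) ∂κ := by
  simp_rw [measureReal_def]
  rw [Measure.prod_apply_symm hE, integral_toReal]
  · exact (measurable_measure_prodMk_right hE).aemeasurable
  · exact Filter.Eventually.of_forall fun y => measure_lt_top _ _

/-- **Common independent factor (right).** `‖μ ⊗ κ − ν ⊗ κ‖ ≤ ‖μ − ν‖` for a probability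
measure `κ`. [folklore] -/
theorem TVClose.prod_left_factor (h : TVClose μ ν ε) [IsFiniteMeasure μ] [IsFiniteMeasure ν]
    [SFinite μ] [SFinite ν] (κ : Measure β) [IsProbabilityMeasure κ] :
    TVClose (μ.prod κ) (ν.prod κ) ε := by
  intro E hE
  rw [measureReal_prod_eq_integral μ κ hE, measureReal_prod_eq_integral ν κ hE]
  have hi1 : Integrable (fun y => μ.real ((fun x => (x, y)) ⁻¹' E)) κ := by
    refine Integrable.of_bound
      (measurable_measure_prodMk_right hE).ennreal_toReal.aestronglyMeasurable (μ.real Set.univ)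
      (Filter.Eventually.of_forall fun y => ?_)
    rw [Real.norm_eq_abs, abs_of_nonneg measureReal_nonneg]
    exact measureReal_mono (Set.subset_univ _)
  have hi2 : Integrable (fun y => ν.real ((fun x => (x, y)) ⁻¹' E)) κ := by
    refine Integrable.of_bound
      (measurable_measure_prodMk_right hE).ennreal_toReal.aestronglyMeasurable (ν.real Set.univ)
      (Filter.Eventually.of_forall fun y => ?_)
    rw [Real.norm_eq_abs, abs_of_nonneg measureReal_nonneg]
    exact measureReal_mono (Set.subset_univ _)
  rw [← integral_sub hi1 hi2]
  calc |∫ y, (μ.real ((fun x => (x, y)) ⁻¹' E) - ν.real ((fun x => (x, y)) ⁻¹' E)) ∂κ|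
      ≤ ∫ y, |μ.real ((fun x => (x, y)) ⁻¹' E) - ν.real ((fun x => (x, y)) ⁻¹' E)| ∂κ :=
        abs_integral_le_integral_abs
    _ ≤ ∫ _y, ε ∂κ := by
        refine integral_mono_of_nonneg (Filter.Eventually.of_forall fun y => abs_nonneg _)
          (integrable_const ε) (Filter.Eventually.of_forall fun y => ?_)
        exact h _ (measurable_prodMk_right hE)
    _ = ε := by simp

/-- **Common independent factor (left).** `‖κ ⊗ μ − κ ⊗ ν‖ ≤ ‖μ − ν‖` for a probability
measure `κ`. [folklore] -/
theorem TVClose.prod_right_factor (h : TVClose μ ν ε) [IsFiniteMeasure μ] [IsFiniteMeasure ν]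
    [SFinite μ] [SFinite ν] (κ : Measure β) [IsProbabilityMeasure κ] :
    TVClose (κ.prod μ) (κ.prod ν) ε := by
  have h1 := (h.prod_left_factor κ).map (measurable_swap (α := α) (β := β))
  rwa [Measure.prod_swap, Measure.prod_swap] at h1

end Prod

section Mixture

/-- **Mixture bound.** Let `F, G : α → β → γ` be jointly measurable and suppose that for every
`a` the laws of `F a` and `G a` under `κ` are `ε(a)`-close. Then the laws of `(a, F a b)` and
`(a, G a b)` under `ρ ⊗ κ` are `∫ ε dρ`-close. (The conditional laws given the first coordinate
are compared fibrewise and the bounds are averaged.) [folklore] -/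
theorem tvClose_map_prod_mixture (ρ : Measure α) (κ : Measure β) [IsProbabilityMeasure ρ]
    [IsProbabilityMeasure κ] {F G : α → β → γ} (hF : Measurable (Function.uncurry F))
    (hG : Measurable (Function.uncurry G)) {ε : α → ℝ} (hεi : Integrable ε ρ)
    (hε : ∀ a, TVClose (κ.map (F a)) (κ.map (G a)) (ε a)) :
    TVClose ((ρ.prod κ).map fun p => (p.1, F p.1 p.2))
      ((ρ.prod κ).map fun p => (p.1, G p.1 p.2)) (∫ a, ε a ∂ρ) := by
  have hΦF : Measurable fun p : α × β => (p.1, F p.1 p.2) := measurable_fst.prodMk hF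
  have hΦG : Measurable fun p : α × β => (p.1, G p.1 p.2) := measurable_fst.prodMk hG
  intro E hE
  rw [map_measureReal_apply hΦF hE, map_measureReal_apply hΦG hE]
  rw [measureReal_def, measureReal_def, Measure.prod_apply (hΦF hE), Measure.prod_apply (hΦG hE)]
  -- fibrewise expressions
  have hfa : ∀ a, MeasurableSet (Prod.mk a ⁻¹' E) := fun a => measurable_prodMk_left hE
  have eF : ∀ a, κ (Prod.mk a ⁻¹' ((fun p : α × β => (p.1, F p.1 p.2)) ⁻¹' E)) =
      (κ.map (F a)) (Prod.mk a ⁻¹' E) := fun a => by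
    rw [Measure.map_apply hF.of_uncurry_left (hfa a)]; rfl
  have eG : ∀ a, κ (Prod.mk a ⁻¹' ((fun p : α × β => (p.1, G p.1 p.2)) ⁻¹' E)) =
      (κ.map (G a)) (Prod.mk a ⁻¹' E) := fun a => by
    rw [Measure.map_apply hG.of_uncurry_left (hfa a)]; rfl
  have mF : Measurable fun a => (κ.map (F a)) (Prod.mk a ⁻¹' E) := by
    have := measurable_measure_prodMk_left (ν := κ) (hΦF hE)
    simp_rw [eF] at this
    exact this
  have mG : Measurable fun a => (κ.map (G a)) (Prod.mk a ⁻¹' E) := by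
    have := measurable_measure_prodMk_left (ν := κ) (hΦG hE)
    simp_rw [eG] at this
    exact this
  simp_rw [eF, eG]
  haveI : ∀ a, IsProbabilityMeasure (κ.map (F a)) := fun a =>
    Measure.isProbabilityMeasure_map (hF.comp measurable_prodMk_left).aemeasurable
  haveI : ∀ a, IsProbabilityMeasure (κ.map (G a)) := fun a =>
    Measure.isProbabilityMeasure_map (hG.comp measurable_prodMk_left).aemeasurable
  rw [← integral_toReal mF.aemeasurable (Filter.Eventually.of_forall fun a => measure_lt_top _ _),
    ← integral_toReal mG.aemeasurable (Filter.Eventually.of_forall fun a => measure_lt_top _ _)]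
  have iF : Integrable (fun a => ((κ.map (F a)) (Prod.mk a ⁻¹' E)).toReal) ρ := by
    refine Integrable.of_bound mF.ennreal_toReal.aestronglyMeasurable 1
      (Filter.Eventually.of_forall fun a => ?_)
    rw [Real.norm_eq_abs, abs_of_nonneg ENNReal.toReal_nonneg]
    exact measureReal_le_one
  have iG : Integrable (fun a => ((κ.map (G a)) (Prod.mk a ⁻¹' E)).toReal) ρ := by
    refine Integrable.of_bound mG.ennreal_toReal.aestronglyMeasurable 1
      (Filter.Eventually.of_forall fun a => ?_)
    rw [Real.norm_eq_abs, abs_of_nonneg ENNReal.toReal_nonneg]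
    exact measureReal_le_one
  rw [← integral_sub iF iG]
  calc |∫ a, (((κ.map (F a)) (Prod.mk a ⁻¹' E)).toReal - ((κ.map (G a)) (Prod.mk a ⁻¹' E)).toReal) ∂ρ|
      ≤ ∫ a, |((κ.map (F a)) (Prod.mk a ⁻¹' E)).toReal - ((κ.map (G a)) (Prod.mk a ⁻¹' E)).toReal| ∂ρ :=
        abs_integral_le_integral_abs
    _ ≤ ∫ a, ε a ∂ρ := by
        refine integral_mono_of_nonneg (Filter.Eventually.of_forall fun a => abs_nonneg _) hεi
          (Filter.Eventually.of_forall fun a => ?_)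
        exact hε a _ (hfa a)

end Mixture

/-! ### Finite products -/

section Pi

/-- **Tensorisation over `Fin n`.** If `μ i` and `ν i` are `ε i`-close probability measures for
every `i`, then `⊗ᵢ μ i` and `⊗ᵢ ν i` are `∑ ε i`-close. [folklore] -/
theorem tvClose_pi {n : ℕ} {X : Type*} [MeasurableSpace X] (μ ν : Fin n → Measure X)
    [∀ i, IsProbabilityMeasure (μ i)] [∀ i, IsProbabilityMeasure (ν i)] {ε : Fin n → ℝ}
    (h : ∀ i, TVClose (μ i) (ν i) (ε i)) :
    TVClose (Measure.pi μ) (Measure.pi ν) (∑ i, ε i) := by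
  induction n with
  | zero =>
    have : Measure.pi μ = Measure.pi ν := by
      refine Measure.pi_eq fun s _ => ?_
      rw [Measure.pi_pi]; simp
    simpa using TVClose.of_eq this le_rfl
  | succ n ih =>
    have e := MeasurableEquiv.piFinSuccAbove (fun _ : Fin (n + 1) => X) 0
    have hμ := (measurePreserving_piFinSuccAbove μ 0)
    have hν := (measurePreserving_piFinSuccAbove ν 0)
    have ih' := ih (fun j => μ (Fin.succ j)) (fun j => ν (Fin.succ j)) (fun j => h (Fin.succ j))
    -- compare the two product decompositions
    have step : TVClose ((μ 0).prod (Measure.pi fun j => μ (Fin.succ j)))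
        ((ν 0).prod (Measure.pi fun j => ν (Fin.succ j))) (ε 0 + ∑ j, ε (Fin.succ j)) :=
      ((h 0).prod_left_factor _).triangle (ih'.prod_right_factor _)
    have step' := step.map (MeasurableEquiv.piFinSuccAbove (fun _ : Fin (n + 1) => X) 0).symm.measurable
    have hμ' : ((μ 0).prod (Measure.pi fun j => μ (Fin.succ j))).map
        (MeasurableEquiv.piFinSuccAbove (fun _ : Fin (n + 1) => X) 0).symm = Measure.pi μ := by
      simpa using hμ.symm.map_eq
    have hν' : ((ν 0).prod (Measure.pi fun j => ν (Fin.succ j))).map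
        (MeasurableEquiv.piFinSuccAbove (fun _ : Fin (n + 1) => X) 0).symm = Measure.pi ν := by
      simpa using hν.symm.map_eq
    rw [hμ', hν'] at step'
    rw [Fin.sum_univ_succ]
    exact step'

end Pi

end Literature.MeasureTheory.TotalVariation
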